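import Summits.RiemannHypothesis.RiemannHypothesis.Theorems.TiltedLandingLaw421R3PairWindow
import Summits.RiemannHypothesis.RiemannHypothesis.Theorems.TiltedLandingLaw421R3PerturbativeRung

/-! # TiltedLandingLaw421R3ChildEnergyTwoLe — lens-2's `ChildEnergyTwoLeQ` BY NAME — W-08 C1 (rh-idea-5 g35), file 3 of 3 (IMAGE C, director (CA666)(A))

SUPPORT module for crux `TiltedLandingLaw421R` ⟨stmt-RiemannHypothesis-33346⟩, route EarlyAppointments (`--supports … --as helper` only; no stub, no crux).
Two tree imports: `…R3PairWindow` (file 2, ns `RhW08.PairWindow`: ★★★ `childEnergy_two_le`, over file 1 `…R3PairCount` = W1 as an INEQUALITY from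
Kim's `J′ ≤ J` = `Splittings.JensenWindow.nonreal_zeros_deriv_le`) and `…R3PerturbativeRung` (#1179 = lens-2 RungP-v5 c66cad57, the typed door
`RhW08.PerturbativeRung.ChildEnergyTwoLeQ`).  Body = SEGMENT D of the checked compose chain
`pub/ideators/rh-idea-5/g35/image/PairWindow-CHAIN-AB-compose-RungPv5-v1-W08-C1-rh-idea-5-g35.lean` 0ab9adf75fb162e5 VERBATIM: the door is PROVED AS
TYPED, no new binder — `BetaLevel`'s `IsLowest` conjunct supplies the band state `StTrkDQ … j v`; `Charged`, `ApproachLevelQ` and lowest-ness are unused.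
What it is NOT: not K-2 (`PerturbativeDropLightQ C μ₀`: door data + located children + pull signs + λ-bookkeeping, open), not RUNG-P, not C′, not the law.
Nothing here bears on the truth of RH; RH is NOT proved; RUNG-P a candidate; ★A / 33346 / 33347 OPEN; checked ≠ landed ≠ proved. -/

namespace RhW08.PairWindowCompose

/-- ★ `ChildEnergyTwoLeQ` BY NAME: `BetaLevel` ↦ its `IsLowest` conjunct ↦ `StTrkDQ … j v`; `Charged`, `ApproachLevelQ`, lowest-ness UNUSED. -/
theorem childEnergyTwoLeQ_holds : RhW08.PerturbativeRung.ChildEnergyTwoLeQ := by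
  intro η f x₀ s hmax R Hs B hE j v z hβ hfl hflz u₁ u₂ hne hd1 hG1 hd2 hG2 hD1 hD2
  obtain ⟨-, -, hlow, ht, ha⟩ := hβ
  exact RhW08.PairWindow.childEnergy_two_le hE hlow.1 ht ha hfl hflz hne hd1 hG1 hd2 hG2 hD1 hD2

end RhW08.PairWindowCompose
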